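import Mathlib
import HarnessLib.Audit
import Summits.PneNP.PneNP.Theorems.PstarPathRank

/-!
# AND-sums constant on a coordinate hyperplane: every edge passes through the frozen variable (ROUND-25, O2 / E2 CASE T step (T1); prover-1 g18)

FRONTIER range-avoidance ladder, rung F-N3 (`stmt-PneNP-19007`), cell `pnp-ideate` (this seat's `HOME/pnp-ideate-prover-1/g18/E2-PLAN.md` §4 (T1));
restricted-model proof complexity — nothing here bears on `P` versus `NP`.

Pure polynomial algebra over `𝔽₂` for AND-sums `Q_S(x) = Σ_{j ∈ S} x_{p_j} x_{q_j}` of a pure instance with simple overlaps (distinct outputs have distinct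
AND pairs):

* `qform_single_and` — `Q_S` vanishes at every basis vector;
* `through_of_const_on_hyperplane` — **if `Q_S` is CONSTANT on the coordinate hyperplane `{x_u = c}` then every output of `S` has `u` in its AND pair**
  (second difference at `e_a, e_b` for an edge `{a, b} ∌ u`: the polar form `B_S(e_a, e_b) = [ab ∈ S] = 1`, while the four points stay in the hyperplane);
* `empty_of_const_on_hyperplane_one` — **and if moreover `c = 1` then `S = ∅`** (an edge `{u, b}` toggles `Q_S` between `e_u` and `e_u + e_b`).

Use (E2 CASE T): in the EQ outcome of the fibre forcing dichotomy on the gate chamber `{x_u = c}` the sum `Q_{D e} + Q_{D e'} = Q_{D e ∆ D e'}` (`PstarChordBridgeKill.qform_symmDiff`) is constant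
there, so `D e ∆ D e' ⊆ star(u)` and the chamber is `{x_u = 0}` — the gate is read with polarity `pol = 1`, as in the PIN + GATE unit.
-/

set_option linter.dupNamespace false -- `Summit.PneNP.PneNP.…`: summit = sub-problem name (D-0017 single-conjunct layout)

open Finset Literature.Computability.Complexity
open Summit.PneNP.PneNP.Theorems.PstarSALevel (SimpleOverlap)
open Summit.PneNP.PneNP.Theorems.PstarProductRank (qform polar polar_apply qform_add)
open Summit.PneNP.PneNP.Theorems.PstarPathRank (AndAdj polar_basis and_ne)

namespace Summit.PneNP.PneNP.Theorems.PstarGateHyperplane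

variable {n m : ℕ}

/-- An AND-sum vanishes at a basis vector (the two AND slots of an output are distinct). -/
theorem qform_single_and (I : LocalMap 4 n m) (hI : I.IsPure xorAndPred) (S : Finset (Fin m)) (b : Fin n) (c : ZMod 2) :
    qform S (fun j => I.vars j 2) (fun j => I.vars j 3) (Pi.single b c) = 0 := by
  unfold qform
  refine sum_eq_zero fun j _ => ?_
  by_cases h2 : I.vars j 2 = b
  · have h3 : I.vars j 3 ≠ b := fun h => and_ne I hI j (h2.trans h.symm)
    rw [Pi.single_eq_of_ne h3, mul_zero]
  · rw [Pi.single_eq_of_ne h2, zero_mul]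

/-- **An AND-sum constant on a coordinate hyperplane passes through the frozen variable.**  If `Q_S(x) = κ` for every `x` with `x_u = c`, then `u`
lies in the AND pair of every output of `S`. -/
theorem through_of_const_on_hyperplane (I : LocalMap 4 n m) (hI : I.IsPure xorAndPred) (hS : SimpleOverlap I) (S : Finset (Fin m)) (u : Fin n)
    (c κ : ZMod 2) (h : ∀ x : Fin n → ZMod 2, x u = c → qform S (fun j => I.vars j 2) (fun j => I.vars j 3) x = κ) :
    ∀ j ∈ S, I.vars j 2 = u ∨ I.vars j 3 = u := by
  intro j hj
  by_contra hnot
  push Not at hnot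
  obtain ⟨hau, hbu⟩ := hnot
  set x₀ : Fin n → ZMod 2 := Pi.single u c with hx₀
  set ea : Fin n → ZMod 2 := Pi.single (I.vars j 2) 1 with hea
  set eb : Fin n → ZMod 2 := Pi.single (I.vars j 3) 1 with heb
  have hx₀u : x₀ u = c := by rw [hx₀, Pi.single_eq_same]
  have heau : ea u = 0 := by rw [hea, Pi.single_eq_of_ne (Ne.symm hau)]
  have hebu : eb u = 0 := by rw [heb, Pi.single_eq_of_ne (Ne.symm hbu)]
  -- the four points of the hyperplane
  have h1 := h x₀ hx₀u
  have h2 := h (x₀ + ea) (by rw [Pi.add_apply, hx₀u, heau, add_zero])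
  have h3 := h (x₀ + eb) (by rw [Pi.add_apply, hx₀u, hebu, add_zero])
  have h4 := h (x₀ + ea + eb) (by rw [Pi.add_apply, Pi.add_apply, hx₀u, heau, hebu, add_zero, add_zero])
  -- polarisation
  rw [qform_add, h2, LinearMap.map_add₂] at h4
  rw [qform_add, h1] at h3
  have hab : polar S (fun j => I.vars j 2) (fun j => I.vars j 3) ea eb = 1 := by
    rw [hea, heb, polar_basis I hI hS S]
    exact if_pos ⟨j, hj, Or.inl ⟨rfl, rfl⟩⟩
  rw [hab] at h4
  have key : ∀ k q b : ZMod 2, k + q + b = k → k + q + (b + 1) = k → False := by decide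
  exact key _ _ _ h3 h4

/-- **… and on the hyperplane `{x_u = 1}` only the empty sum is constant.** -/
theorem empty_of_const_on_hyperplane_one (I : LocalMap 4 n m) (hI : I.IsPure xorAndPred) (hS : SimpleOverlap I) (S : Finset (Fin m))
    (u : Fin n) (κ : ZMod 2) (h : ∀ x : Fin n → ZMod 2, x u = 1 → qform S (fun j => I.vars j 2) (fun j => I.vars j 3) x = κ) : S = ∅ := by
  by_contra hne
  obtain ⟨j, hj⟩ := nonempty_iff_ne_empty.2 hne
  -- `j` passes through `u`; let `b` be its other AND variable
  obtain ⟨b, hbu, hadj⟩ : ∃ b : Fin n, b ≠ u ∧ ((I.vars j 2 = u ∧ I.vars j 3 = b) ∨ (I.vars j 2 = b ∧ I.vars j 3 = u)) := by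
    rcases through_of_const_on_hyperplane I hI hS S u 1 κ h j hj with h2 | h3
    · exact ⟨I.vars j 3, fun hh => and_ne I hI j (h2.trans hh.symm), Or.inl ⟨h2, rfl⟩⟩
    · exact ⟨I.vars j 2, fun hh => and_ne I hI j (hh.trans h3.symm), Or.inr ⟨rfl, h3⟩⟩
  set x₀ : Fin n → ZMod 2 := Pi.single u 1 with hx₀
  set eb : Fin n → ZMod 2 := Pi.single b 1 with heb
  have hx₀u : x₀ u = 1 := by rw [hx₀, Pi.single_eq_same]
  have hebu : eb u = 0 := by rw [heb, Pi.single_eq_of_ne hbu.symm]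
  have h1 := h x₀ hx₀u
  have h2 := h (x₀ + eb) (by rw [Pi.add_apply, hx₀u, hebu, add_zero])
  rw [qform_add, h1, heb, qform_single_and I hI S b 1, hx₀, polar_basis I hI hS S] at h2
  rw [if_pos ⟨j, hj, hadj⟩] at h2
  have key : ∀ k : ZMod 2, k + 0 + 1 = k → False := by decide
  exact key _ h2

/-- Both facts on the hyperplane `{x_u = c}`, packaged: every output of `S` passes through `u`, and `c = 1 ⟹ S = ∅`. -/
theorem const_on_hyperplane (I : LocalMap 4 n m) (hI : I.IsPure xorAndPred) (hS : SimpleOverlap I) (S : Finset (Fin m)) (u : Fin n)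
    (c κ : ZMod 2) (h : ∀ x : Fin n → ZMod 2, x u = c → qform S (fun j => I.vars j 2) (fun j => I.vars j 3) x = κ) :
    (∀ j ∈ S, I.vars j 2 = u ∨ I.vars j 3 = u) ∧ (c = 1 → S = ∅) :=
  ⟨through_of_const_on_hyperplane I hI hS S u c κ h, fun hc =>
    empty_of_const_on_hyperplane_one I hI hS S u κ (fun x hx => h x (by rw [hx, hc]))⟩

end Summit.PneNP.PneNP.Theorems.PstarGateHyperplane
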